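import Literature.Algebra.Polynomial.CircuitBoundaryZeros

/-!
# Agiforms: circuit polynomials with `Θ`-normalised coefficients, and the Hurwitz form

[cite: Reznick1989, §1 (agiforms `f(𝔘, λ) = ∑ λ_i x^{u_i} − x^{∑ λ_i u_i}`, nonnegative by the
arithmetic-geometric inequality; as quoted in IlimanDewolff2016 §2.3)]
[cite: IlimanDewolff2016, §2.3 («Given an even lattice simplex Δ ⊂ ℝⁿ and an interior lattice point
y ∈ int(Δ), the corresponding agiform to Δ and y is given by
f(Δ,λ,y) = ∑_{i=0}^n λ_i x^{α(i)} − x^y where y = ∑ λ_i α(i) ∈ ℕⁿ with ∑ λ_i = 1 and λ_i ≥ 0. …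
the polynomial f(Δ,λ,y) is nonnegative by the arithmetic-geometric mean inequality. Note that an
agiform has a zero at the all ones vector 𝟏. This implies that agiforms lie on the boundary of the
cone of nonnegative polynomials.»), Example 2.8 («The standard (Hurwitz-)simplex given by
conv{0, 2d·e_1, …, 2d·e_n}»), §5 («Agiforms can be recovered by setting b_j = λ_j»),
Corollary 4.1 / arXiv Cor. 18 (zeros of boundary circuit polynomials)]

In the language of the companion files an AGIFORM is the circuit polynomial whose coefficients ARE
its barycentric weights, `b = λ`, with inner coefficient `c = −1`:

* its circuit number is `Θ(λ, λ) = ∏ (λ_j/λ_j)^{λ_j} = 1` (`circuitNumber_self`; more generally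
  `Θ(t·b, λ) = t·Θ(b, λ)`, `circuitNumber_smul`), so `|c| = 1 = Θ`: an agiform sits exactly ON
  the circuit-number boundary;
* hence it is nonnegative (`agiform_nonneg`, the weighted AM/GM inequality for monomials, via
  `CircuitNumberNonnegativity.circuitPolynomial_nonneg_of_abs_le`) and vanishes at the all-ones
  vector (`agiform_apply_one`), while `∑ λ_j x^{α(j)} − (1 + ε) x^y` is negative there for every
  `ε > 0` (`agiform_perturb_neg_at_one`): it lies on the boundary of the nonnegativity cone;
* for a full-dimensional simplex (`n + 1` affinely independent even vertices) its zeros in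
  `(ℝ∖{0})ⁿ` are SIGN VECTORS, `|x_i| = 1` (`abs_eq_one_of_agiform_eq_zero`) — the norm minimiser
  of the companion files is `s* = 0`, `e^{s*} = 𝟏`.

The Hurwitz simplex `conv{2dN·e_j}` with equal weights `λ_j = 1/N` (`N = #variables`) and inner
point `y = (2d, …, 2d)` gives the polynomial AM/GM inequality
`N · ∏_i x_i^{2d} ≤ ∑_j x_j^{2dN}` (`card_mul_prod_pow_le_sum_pow`, Hurwitz 1891), e.g.
`x₁²x₂²⋯x_N² ≤ (x₁^{2N} + … + x_N^{2N})/N`.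

All statements are fully proved; no named facts are introduced.  Not formalised: Reznick's theorem
that an agiform is a sum of squares iff `y ∈ Δ*` (the maximal mediated set), Hurwitz's explicit
sum-of-squares representation of `∑ x_j^{2N} − N ∏ x_j²`.
-/

namespace Literature.Algebra.Polynomial.CircuitAgiform

open Finset Matrix Literature.Algebra.Polynomial.CircuitNumberNonnegativity
open Literature.Algebra.Polynomial.CircuitNormMinimiser
open Literature.Algebra.Polynomial.CircuitBoundaryZeros

section CircuitNumber

variable {ι : Type*} [Fintype ι]

/-- `Θ` is positively homogeneous of degree one in the coefficients: `Θ(t·b, λ) = t·Θ(b, λ)` for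
`t ≥ 0` when `∑ λ_j = 1`.
[cite: IlimanDewolff2016, Definition 3.1 / §5 (Θ_f = ∏ (b_j/λ_j)^{λ_j})] -/
theorem circuitNumber_smul {b w : ι → ℝ} (hb : ∀ j, 0 ≤ b j) (hw : ∀ j, 0 ≤ w j)
    (hw1 : ∑ j, w j = 1) {t : ℝ} (ht : 0 ≤ t) :
    circuitNumber (t • b) w = t * circuitNumber b w := by
  unfold circuitNumber
  have h : ∀ j, (((t • b) j) / w j) ^ w j = t ^ w j * (b j / w j) ^ w j := by
    intro j
    rw [Pi.smul_apply, smul_eq_mul, mul_div_assoc, Real.mul_rpow ht (div_nonneg (hb j) (hw j))]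
  simp_rw [h]
  rw [prod_mul_distrib, ← Real.rpow_sum_of_nonneg ht (fun j _ => hw j), hw1, Real.rpow_one]

/-- **An agiform sits on the circuit-number boundary**: with coefficients equal to the weights,
`Θ(λ, λ) = ∏ (λ_j/λ_j)^{λ_j} = 1` (a vanishing weight contributes the factor `0⁰ = 1`).
[cite: IlimanDewolff2016, §5 («Agiforms can be recovered by setting b_j = λ_j»)]
[cite: Reznick1989, §1] -/
theorem circuitNumber_self {w : ι → ℝ} (hw : ∀ j, 0 ≤ w j) : circuitNumber w w = 1 := by
  unfold circuitNumber
  refine prod_eq_one fun j _ => ?_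
  rcases (hw j).eq_or_lt with h | h
  · rw [← h, Real.rpow_zero]
  · rw [div_self h.ne', Real.one_rpow]

end CircuitNumber

section Agiform

variable {ι : Type*} [Fintype ι] {n : Type*} [Fintype n]

/-- **Agiforms are nonnegative** (the arithmetic-geometric inequality for monomials): for weights
`λ ≥ 0` with `∑ λ_j = 1`, even exponents `α(j) ∈ (2ℕ)ⁿ` and the lattice point
`y = ∑ λ_j α(j) ∈ ℕⁿ`, `∑_j λ_j x^{α(j)} − x^y ≥ 0` on `ℝⁿ`.
[cite: Reznick1989, §1 (agiforms; «nonnegative by the arithmetic-geometric mean inequality», as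
quoted in IlimanDewolff2016 §2.3)]
[cite: IlimanDewolff2016, Theorem 3.8 (2) ⇒ (1) with b = λ, c = −1 = −Θ] -/
theorem agiform_nonneg {w : ι → ℝ} (hw : ∀ j, 0 ≤ w j) (hw1 : ∑ j, w j = 1) {a : ι → n → ℕ}
    (ha : ∀ j i, Even (a j i)) {y : n → ℕ} (hy : ∀ i, (y i : ℝ) = ∑ j, w j * a j i)
    (x : n → ℝ) : 0 ≤ ∑ j, w j * ∏ i, x i ^ a j i - ∏ i, x i ^ y i := by
  have hc : |(-1 : ℝ)| ≤ circuitNumber w w := by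
    rw [abs_neg, abs_one, circuitNumber_self hw]
  have h := circuitPolynomial_nonneg_of_abs_le hw hw hw1 ha hy hc x
  linarith

/-- An agiform vanishes at the all-ones vector `𝟏` (every monomial evaluates to `1` and
`∑ λ_j = 1`).
[cite: IlimanDewolff2016, §2.3 («Note that an agiform has a zero at the all ones vector 𝟏»)] -/
theorem agiform_apply_one {w : ι → ℝ} (hw1 : ∑ j, w j = 1) (a : ι → n → ℕ) (y : n → ℕ) :
    ∑ j, w j * ∏ i, (1 : n → ℝ) i ^ a j i - ∏ i, (1 : n → ℝ) i ^ y i = 0 := by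
  simp [hw1]

/-- … so it lies on the BOUNDARY of the cone of nonnegative polynomials supported on its circuit:
increasing the inner coefficient by any `ε > 0` produces the negative value `−ε` at `𝟏`.
[cite: IlimanDewolff2016, §2.3 («This implies that agiforms lie on the boundary of the cone of
nonnegative polynomials»)] -/
theorem agiform_perturb_neg_at_one {w : ι → ℝ} (hw1 : ∑ j, w j = 1) (a : ι → n → ℕ) (y : n → ℕ)
    {ε : ℝ} (hε : 0 < ε) :
    ∑ j, w j * ∏ i, (1 : n → ℝ) i ^ a j i - (1 + ε) * ∏ i, (1 : n → ℝ) i ^ y i < 0 := by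
  simp [hw1]
  linarith

/-- In the format of the companion files (`+ c·x^y` with `c = −1`): the agiform is the circuit
polynomial with `b = λ` and `c = −1`, and `|c| = Θ(λ, λ)`.
[cite: IlimanDewolff2016, §5 («Agiforms can be recovered by setting b_j = λ_j»)] -/
theorem agiform_eq_circuitPolynomial (w : ι → ℝ) (a : ι → n → ℕ) (y : n → ℕ) (x : n → ℝ) :
    ∑ j, w j * ∏ i, x i ^ a j i - ∏ i, x i ^ y i
      = ∑ j, w j * ∏ i, x i ^ a j i + (-1) * ∏ i, x i ^ y i := by
  ring

/-- **Real zeros of a full-dimensional agiform are sign vectors.**  If the `n + 1` even vertices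
`α(j)` are affinely independent and the weights are positive, every zero `x ∈ (ℝ∖{0})ⁿ` of
`∑ λ_j x^{α(j)} − x^y` has `|x_i| = 1` for all `i`: the norm minimiser of the companion files is
`s* = 0` (all outer terms `λ_j e^{⟨α(j), 0⟩} = λ_j · Θ · e^{⟨y, 0⟩}` are equalised at the origin),
so
[IlimanDewolff2016, Cor. 4.1] places the zeros at `|x_i| = e^{s*_i} = 1`.
[cite: IlimanDewolff2016, Corollary 4.1 / arXiv Cor. 18 («v ∈ V(f) if and only if |v| = e^{s*}»)]
[cite: Reznick1989, §1] -/
theorem abs_eq_one_of_agiform_eq_zero {w : ι → ℝ} (hw : ∀ j, 0 < w j) (hw1 : ∑ j, w j = 1)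
    {a : ι → n → ℕ} (ha : ∀ j i, Even (a j i))
    (hα : AffineIndependent ℝ (fun j i => (a j i : ℝ)))
    (hcard : Fintype.card ι = Fintype.card n + 1) {y : n → ℕ}
    (hy : ∀ i, (y i : ℝ) = ∑ j, w j * a j i) {x : n → ℝ} (hx0 : ∀ i, x i ≠ 0)
    (hx : ∑ j, w j * ∏ i, x i ^ a j i - ∏ i, x i ^ y i = 0) (i : n) : |x i| = 1 := by
  have hΘ : circuitNumber w w = 1 := circuitNumber_self fun j => (hw j).le
  have hc : |(-1 : ℝ)| = circuitNumber w w := by rw [abs_neg, abs_one, hΘ]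
  have hs : ∀ j, w j * Real.exp ((fun i => (a j i : ℝ)) ⬝ᵥ (0 : n → ℝ))
      = w j * circuitNumber w w * Real.exp ((fun i => (y i : ℝ)) ⬝ᵥ (0 : n → ℝ)) := by
    intro j
    simp [hΘ]
  have hx' : ∑ j, w j * ∏ i, x i ^ a j i + (-1) * ∏ i, x i ^ y i = 0 := by
    rw [← agiform_eq_circuitPolynomial]; exact hx
  have h := abs_eq_exp_of_circuitPolynomial_eq_zero (fun j => hw j) hw hw1 ha hα hcard hy hc hs
    hx0 hx' i
  rwa [Pi.zero_apply, Real.exp_zero] at h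

/-- Conversely every sign vector with `x^y = 1`, in particular `𝟏` itself and, when `y` is even,
all of `{±1}ⁿ`, is a zero: at a sign vector every even outer monomial is `1`.
[cite: IlimanDewolff2016, Corollary 4.1 / arXiv Cor. 18 (the zeros are the sign patterns of e^{s*}
with the right sign of the inner monomial)] -/
theorem agiform_eq_zero_of_abs_eq_one {w : ι → ℝ} (hw1 : ∑ j, w j = 1) {a : ι → n → ℕ}
    (ha : ∀ j i, Even (a j i)) (y : n → ℕ) {x : n → ℝ} (hx1 : ∀ i, |x i| = 1)
    (hxy : ∏ i, x i ^ y i = 1) : ∑ j, w j * ∏ i, x i ^ a j i - ∏ i, x i ^ y i = 0 := by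
  have hout : ∀ j, ∏ i, x i ^ a j i = 1 := by
    intro j
    refine prod_eq_one fun i _ => ?_
    obtain ⟨k, hk⟩ := ha j i
    rw [hk, ← two_mul, pow_mul, ← sq_abs (x i), hx1 i, one_pow, one_pow]
  simp only [hout, mul_one, hw1, hxy, sub_self]

end Agiform

/-! ### The Hurwitz form: the polynomial AM/GM inequality -/

section Hurwitz

variable {n : Type*} [Fintype n] [DecidableEq n]

/-- A monomial with a single active variable: `∏_i x_i^{[i = j]·m} = x_j^m`. [folklore] -/
private theorem prod_pow_ite_eq (x : n → ℝ) (j : n) (m : ℕ) :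
    ∏ i, x i ^ (if i = j then m else 0) = x j ^ m := by
  have h : ∀ i, x i ^ (if i = j then m else 0) = if i = j then x i ^ m else 1 := by
    intro i
    split_ifs <;> simp
  simp_rw [h]
  rw [prod_ite_eq']
  simp

/-- **The Hurwitz form is an agiform, hence nonnegative** (polynomial AM/GM inequality): for
`N = #n ≥ 1` variables and `d ∈ ℕ`,
`N · ∏_i x_i^{2d} ≤ ∑_j x_j^{2dN}`,
the agiform of the Hurwitz simplex `conv{2dN·e_j : j}` with equal weights `1/N` and inner lattice
point `(2d, …, 2d)`.  (`N = 0`: both sides vanish.)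
[cite: IlimanDewolff2016, Example 2.8 («The standard (Hurwitz-)simplex given by
conv{0, 2d·e_1, …, 2d·e_n} … is an H-simplex») and §2.3]
[cite: Reznick1989, §1 (Hurwitz's 1891 proof of the arithmetic-geometric inequality via forms)] -/
theorem card_mul_prod_pow_le_sum_pow (x : n → ℝ) (d : ℕ) :
    (Fintype.card n : ℝ) * ∏ i, x i ^ (2 * d) ≤ ∑ j, x j ^ (2 * d * Fintype.card n) := by
  rcases Nat.eq_zero_or_pos (Fintype.card n) with h0 | hN
  · haveI : IsEmpty n := Fintype.card_eq_zero_iff.mp h0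
    simp
  set N : ℕ := Fintype.card n with hN_def
  have hNr : (N : ℝ) ≠ 0 := by exact_mod_cast hN.ne'
  -- the agiform data of the Hurwitz simplex
  have hw : ∀ j : n, (0 : ℝ) ≤ (fun _ : n => (1 : ℝ) / N) j := fun _ => by positivity
  have hw1 : ∑ j : n, (fun _ : n => (1 : ℝ) / N) j = 1 := by
    rw [sum_const, card_univ, nsmul_eq_mul, ← hN_def]
    field_simp
  have ha : ∀ j i : n, Even ((fun j i : n => if i = j then 2 * d * N else 0) j i) := by
    intro j i
    dsimp only
    split_ifs
    · exact ⟨d * N, by ring⟩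
    · exact ⟨0, rfl⟩
  have hy : ∀ i : n, (((fun _ : n => 2 * d) i : ℕ) : ℝ)
      = ∑ j : n, (fun _ : n => (1 : ℝ) / N) j
        * ((fun j i : n => if i = j then 2 * d * N else 0) j i : ℕ) := by
    intro i
    dsimp only
    have h : ∀ j : n, (1 : ℝ) / N * ((if i = j then 2 * d * N else 0 : ℕ) : ℝ)
        = if i = j then (2 * d : ℝ) else 0 := by
      intro j
      split_ifs
      · push_cast
        field_simp
      · simp
    simp_rw [h]
    rw [sum_ite_eq, if_pos (mem_univ i)]
    push_cast
    ring
  have h := agiform_nonneg hw hw1 ha hy x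
  simp_rw [prod_pow_ite_eq] at h
  have hsum : ∑ j : n, (1 : ℝ) / N * x j ^ (2 * d * N) = (1 / N) * ∑ j, x j ^ (2 * d * N) := by
    rw [mul_sum]
  rw [hsum] at h
  have hNpos : (0 : ℝ) < N := by exact_mod_cast hN
  have h' : ∏ i, x i ^ (2 * d) ≤ (1 / (N : ℝ)) * ∑ j, x j ^ (2 * d * N) := by linarith
  calc (N : ℝ) * ∏ i, x i ^ (2 * d) ≤ (N : ℝ) * ((1 / (N : ℝ)) * ∑ j, x j ^ (2 * d * N)) :=
        mul_le_mul_of_nonneg_left h' hNpos.le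
    _ = ∑ j, x j ^ (2 * d * N) := by field_simp

/-- The case `d = 1`: `x₁² x₂² ⋯ x_N² ≤ (x₁^{2N} + ⋯ + x_N^{2N}) / N`, i.e.
`∑_j x_j^{2N} − N ∏_j x_j² ≥ 0` — Hurwitz's form.
[cite: Reznick1989, §1] [cite: IlimanDewolff2016, Example 2.8] -/
theorem hurwitzForm_nonneg (x : n → ℝ) :
    0 ≤ ∑ j, x j ^ (2 * Fintype.card n) - (Fintype.card n : ℝ) * ∏ i, x i ^ 2 := by
  have h := card_mul_prod_pow_le_sum_pow x 1
  simp only [mul_one] at h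
  linarith

end Hurwitz

end Literature.Algebra.Polynomial.CircuitAgiform
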